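import Summits.AtomisticToContinuum.FouriersLaw.Theses.FeketeSeriesLaw

/-!
# BC3 birth skeleton — crux `QuasiSubadditiveResistance` (stmt-AtomisticToContinuum-14041) of route FeketeSeriesLaw

Crux (route decl `Summit.AtomisticToContinuum.FouriersLaw.Theses.FeketeSeriesLaw.QuasiSubadditiveResistance`):
for `pinnedChain ω₂ lam β γ` (all `> 0`), under uniqueness of weak steady states, along every steady-state
family `μ`, every `T > 0` and every sequence of response coefficients `D`
(`D n = lim_{δ → 0, δ ≠ 0} totalCurrent (μ n (T+δ/2) (T-δ/2)) / δ`):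
`∃ C ∀ N M ≥ 2, R_{N+M} ≤ R_N + R_M + C` with the bath-to-bath resistance `R_n := (n-1)/D n`.

## The line (two stubs): THE KINETIC TEMPERATURE AT THE CUT IS THE SELF-CONSISTENT RESERVOIR

Concatenate: the `(N+M)`-chain at bias `δ > 0` is the `N`-block (sites `0 … N-1`) followed by the
`M`-block (sites `N … N+M-1`).  Let `τ(δ) := ∫ p_{N-1}² dμ_{N+M, T+δ/2, T-δ/2}` be the kinetic
temperature of the PROBE SITE `N-1` (last site of the upstream block).  The total drop `δ` splits
EXACTLY as `δ = [(T+δ/2) − τ(δ)] + [τ(δ) − (T−δ/2)]` (upstream drop: left bath → probe site;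
downstream drop: probe site → right bath, through the junction bond and the `M`-block), so with the
drop FRACTIONS `A(δ) := ((T+δ/2) − τ(δ))/δ`, `B(δ) := (τ(δ) − (T−δ/2))/δ` one has `A + B = 1` and
`R_{N+M} = A·R_{N+M} + B·R_{N+M}` = (in-situ upstream resistance) + (in-situ downstream resistance).

* `stub_upstreamTermination` — OUTLET LOCALITY: `∃ C ∀ N M ≥ 2`, eventually as `δ → 0⁺`,
  `A(δ) · R_{N+M} ≤ R_N + C`: an `N`-block fed by the Langevin bath at its inlet and discharging into
  the rest of the chain (a passive anharmonic load) instead of into its outlet bath shows, from the bath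
  to its last site, at most the bath-to-bath resistance of the same block plus a contact constant
  (replacing the outlet reservoir by the chain costs `O(1)`: Büttiker-probe / reservoir-insertion
  picture, BonettoLebowitzLukkarinenOlla2009, Dhar2008 §3; diffusive phenomenology
  `A·R_{N+M} = r_c + (N-1) r ≤ 2 r_c + (N-1) r = R_N`, LepriLiviPoliti2003 §6, AokiKusnezov2001).
* `stub_downstreamTermination` — INLET LOCALITY: `∃ C ∀ N M ≥ 2`, eventually as `δ → 0⁺`,
  `B(δ) · R_{N+M} ≤ R_M + C`: the `M`-block driven through the junction bond by the upstream chain at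
  probe temperature `τ` (an active anharmonic source replacing the inlet Langevin bath at the same
  temperature) and discharging into its own outlet bath shows, from the probe site to the bath, at most
  the bath-to-bath resistance of the bathed `M`-chain plus a contact constant
  (phenomenology `B·R_{N+M} = M r + r_c ≤ R_M + (r - r_c)`).

Neither stub gives the crux alone (the other drop fraction is uncontrolled), neither mentions `R_N`
AND `R_M`, and the probe temperature `τ` is what makes the split adaptive (`A ≈ N/(N+M)` in the
diffusive regime; with `τ` replaced by any `N`-independent proxy both stubs are false).  The stubs are
`limsup`-type statements at positive bias only (`𝓝[>] 0`), so NO existence of a local-temperature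
response coefficient is claimed; integrability of `p_{N-1}²` under the (unique, CEHR2018 Thm 2.13)
steady state is part of each claim (else the Bochner junk value `0` makes `A(δ) → +∞`).

Assembly (seam `quasiSubadditiveResistance_of_stubs`, sorry-free, standard axioms): pick one `δ > 0` in
the intersection of the two eventualities (`𝓝[>] 0` is non-trivial), add, use `A + B = 1`:
`R_{N+M} ≤ R_N + R_M + (C₁ + C₂)`.  Skeleton theorem
`QuasiSubadditiveResistance_of : FeketeSeriesLaw.QuasiSubadditiveResistance` (crux BY NAME).

Disproof used: none exists for this crux (`Cruxes/QuasiSubadditiveResistance/` absent before this file;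
`ledger negatives --problem AtomisticToContinuum`: no FouriersLaw entry on this decl).  The landed
Negative lemmas of the sibling crux `JunctionLocality.SuperadditiveResistance`
(`Theorems/SuperadditiveResistance/Negative/{HarmonicCornerTightness,KillCriteria}`) concern the
harmonic corner `lam = β = 0` and the SUPERadditive direction; both stubs here carry the crux's own
prefix `0 < lam`, `0 < β` and the SUBadditive direction, so no stub is an instance they refute.  The
landed implication `AffineResistanceLaw → QuasiSubadditiveResistance`
(`JunctionLocalitySuperadditiveResistanceCruxPositionQuasiSubadditive`) is a different (rate-level,
summit-strength) sufficient condition and is deliberately NOT a stub here.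
-/

namespace Summit.AtomisticToContinuum.FouriersLaw.Cruxes.QuasiSubadditiveResistance.Birth

open MeasureTheory Filter Topology
open Literature.MathematicalPhysics.KineticTheory.HeatConduction

/-- STUB U — upstream (outlet) termination locality.  Under uniqueness of weak steady states of
`pinnedChain ω₂ lam β γ` (all `> 0`), along every steady-state family `μ`, every `T > 0` and response
coefficients `D`: there is `C` such that for all `N, M ≥ 2` and the probe site `s = N-1` of the
`(N+M)`-chain, eventually as `δ → 0⁺`,
`((T + δ/2 − ∫ p_s² dμ_{N+M,T+δ/2,T−δ/2}) / δ) · (N+M−1)/D(N+M) ≤ (N−1)/D N + C`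
— the in-situ resistance of the upstream `N`-block (left bath → its last site) is at most the
bath-to-bath resistance `R_N` of the bathed `N`-chain plus a contact constant. -/
theorem stub_upstreamTermination :
    ∀ ω₂ lam β γ : ℝ, 0 < ω₂ → 0 < lam → 0 < β → 0 < γ →
    (∀ (N : ℕ) (T_L T_R : ℝ), 0 < T_L → 0 < T_R → ∀ μ ν : Measure (PhaseSpace N),
      (pinnedChain ω₂ lam β γ).IsSteadyState N T_L T_R μ →
      (pinnedChain ω₂ lam β γ).IsSteadyState N T_L T_R ν → μ = ν) →
    ∀ μ : (N : ℕ) → ℝ → ℝ → Measure (PhaseSpace N),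
      (∀ (N : ℕ) (T_L T_R : ℝ), 0 < T_L → 0 < T_R →
        (pinnedChain ω₂ lam β γ).IsSteadyState N T_L T_R (μ N T_L T_R)) →
    ∀ T : ℝ, 0 < T → ∀ D : ℕ → ℝ,
      (∀ N : ℕ, Tendsto (fun δ : ℝ =>
        (pinnedChain ω₂ lam β γ).totalCurrent (μ N (T + δ / 2) (T - δ / 2)) / δ)
        (nhdsWithin 0 {(0 : ℝ)}ᶜ) (nhds (D N))) →
    ∃ C : ℝ, ∀ N M : ℕ, 2 ≤ N → 2 ≤ M → ∀ s : Fin (N + M), s.val = N - 1 →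
      ∀ᶠ δ : ℝ in nhdsWithin 0 (Set.Ioi 0),
        (T + δ / 2 - ∫ x, (x.2 s) ^ 2 ∂(μ (N + M) (T + δ / 2) (T - δ / 2))) / δ *
            (((N + M - 1 : ℕ) : ℝ) / D (N + M)) ≤
          ((N - 1 : ℕ) : ℝ) / D N + C := by
  sorry

/-- STUB D — downstream (inlet) termination locality.  Same prefix; there is `C` such that for all
`N, M ≥ 2` and the probe site `s = N-1` of the `(N+M)`-chain, eventually as `δ → 0⁺`,
`((∫ p_s² dμ_{N+M,T+δ/2,T−δ/2} − (T − δ/2)) / δ) · (N+M−1)/D(N+M) ≤ (M−1)/D M + C`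
— the in-situ resistance of the downstream part (probe site → junction bond → `M`-block → right
bath), driven by the upstream chain at the probe temperature instead of by a Langevin bath at that
temperature, is at most the bath-to-bath resistance `R_M` of the bathed `M`-chain plus a contact
constant. -/
theorem stub_downstreamTermination :
    ∀ ω₂ lam β γ : ℝ, 0 < ω₂ → 0 < lam → 0 < β → 0 < γ →
    (∀ (N : ℕ) (T_L T_R : ℝ), 0 < T_L → 0 < T_R → ∀ μ ν : Measure (PhaseSpace N),
      (pinnedChain ω₂ lam β γ).IsSteadyState N T_L T_R μ →
      (pinnedChain ω₂ lam β γ).IsSteadyState N T_L T_R ν → μ = ν) →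
    ∀ μ : (N : ℕ) → ℝ → ℝ → Measure (PhaseSpace N),
      (∀ (N : ℕ) (T_L T_R : ℝ), 0 < T_L → 0 < T_R →
        (pinnedChain ω₂ lam β γ).IsSteadyState N T_L T_R (μ N T_L T_R)) →
    ∀ T : ℝ, 0 < T → ∀ D : ℕ → ℝ,
      (∀ N : ℕ, Tendsto (fun δ : ℝ =>
        (pinnedChain ω₂ lam β γ).totalCurrent (μ N (T + δ / 2) (T - δ / 2)) / δ)
        (nhdsWithin 0 {(0 : ℝ)}ᶜ) (nhds (D N))) →
    ∃ C : ℝ, ∀ N M : ℕ, 2 ≤ N → 2 ≤ M → ∀ s : Fin (N + M), s.val = N - 1 →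
      ∀ᶠ δ : ℝ in nhdsWithin 0 (Set.Ioi 0),
        (∫ x, (x.2 s) ^ 2 ∂(μ (N + M) (T + δ / 2) (T - δ / 2)) - (T - δ / 2)) / δ *
            (((N + M - 1 : ℕ) : ℝ) / D (N + M)) ≤
          ((M - 1 : ℕ) : ℝ) / D M + C := by
  sorry

/-- SEAM (real proof, sorry-free): the two termination inequalities, evaluated at one common bias
`δ > 0` (the filter `𝓝[>] 0` is non-trivial), add up — the drop fractions sum to `1` exactly because
the probe temperature cancels — to the series law with junction defect `C₁ + C₂`.  Statement:
`stub_upstreamTermination`-signature → `stub_downstreamTermination`-signature → the DEFINIENS of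
`FeketeSeriesLaw.QuasiSubadditiveResistance` verbatim. -/
theorem quasiSubadditiveResistance_of_stubs :
    (∀ ω₂ lam β γ : ℝ, 0 < ω₂ → 0 < lam → 0 < β → 0 < γ →
    (∀ (N : ℕ) (T_L T_R : ℝ), 0 < T_L → 0 < T_R → ∀ μ ν : Measure (PhaseSpace N),
      (pinnedChain ω₂ lam β γ).IsSteadyState N T_L T_R μ →
      (pinnedChain ω₂ lam β γ).IsSteadyState N T_L T_R ν → μ = ν) →
    ∀ μ : (N : ℕ) → ℝ → ℝ → Measure (PhaseSpace N),
      (∀ (N : ℕ) (T_L T_R : ℝ), 0 < T_L → 0 < T_R →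
        (pinnedChain ω₂ lam β γ).IsSteadyState N T_L T_R (μ N T_L T_R)) →
    ∀ T : ℝ, 0 < T → ∀ D : ℕ → ℝ,
      (∀ N : ℕ, Tendsto (fun δ : ℝ =>
        (pinnedChain ω₂ lam β γ).totalCurrent (μ N (T + δ / 2) (T - δ / 2)) / δ)
        (nhdsWithin 0 {(0 : ℝ)}ᶜ) (nhds (D N))) →
    ∃ C : ℝ, ∀ N M : ℕ, 2 ≤ N → 2 ≤ M → ∀ s : Fin (N + M), s.val = N - 1 →
      ∀ᶠ δ : ℝ in nhdsWithin 0 (Set.Ioi 0),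
        (T + δ / 2 - ∫ x, (x.2 s) ^ 2 ∂(μ (N + M) (T + δ / 2) (T - δ / 2))) / δ *
            (((N + M - 1 : ℕ) : ℝ) / D (N + M)) ≤
          ((N - 1 : ℕ) : ℝ) / D N + C) →
    (∀ ω₂ lam β γ : ℝ, 0 < ω₂ → 0 < lam → 0 < β → 0 < γ →
    (∀ (N : ℕ) (T_L T_R : ℝ), 0 < T_L → 0 < T_R → ∀ μ ν : Measure (PhaseSpace N),
      (pinnedChain ω₂ lam β γ).IsSteadyState N T_L T_R μ →
      (pinnedChain ω₂ lam β γ).IsSteadyState N T_L T_R ν → μ = ν) →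
    ∀ μ : (N : ℕ) → ℝ → ℝ → Measure (PhaseSpace N),
      (∀ (N : ℕ) (T_L T_R : ℝ), 0 < T_L → 0 < T_R →
        (pinnedChain ω₂ lam β γ).IsSteadyState N T_L T_R (μ N T_L T_R)) →
    ∀ T : ℝ, 0 < T → ∀ D : ℕ → ℝ,
      (∀ N : ℕ, Tendsto (fun δ : ℝ =>
        (pinnedChain ω₂ lam β γ).totalCurrent (μ N (T + δ / 2) (T - δ / 2)) / δ)
        (nhdsWithin 0 {(0 : ℝ)}ᶜ) (nhds (D N))) →
    ∃ C : ℝ, ∀ N M : ℕ, 2 ≤ N → 2 ≤ M → ∀ s : Fin (N + M), s.val = N - 1 →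
      ∀ᶠ δ : ℝ in nhdsWithin 0 (Set.Ioi 0),
        (∫ x, (x.2 s) ^ 2 ∂(μ (N + M) (T + δ / 2) (T - δ / 2)) - (T - δ / 2)) / δ *
            (((N + M - 1 : ℕ) : ℝ) / D (N + M)) ≤
          ((M - 1 : ℕ) : ℝ) / D M + C) →
    (∀ ω₂ lam β γ : ℝ, 0 < ω₂ → 0 < lam → 0 < β → 0 < γ →
    (∀ (N : ℕ) (T_L T_R : ℝ), 0 < T_L → 0 < T_R → ∀ μ ν : Measure (PhaseSpace N),
      (pinnedChain ω₂ lam β γ).IsSteadyState N T_L T_R μ →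
      (pinnedChain ω₂ lam β γ).IsSteadyState N T_L T_R ν → μ = ν) →
    ∀ μ : (N : ℕ) → ℝ → ℝ → Measure (PhaseSpace N),
      (∀ (N : ℕ) (T_L T_R : ℝ), 0 < T_L → 0 < T_R →
        (pinnedChain ω₂ lam β γ).IsSteadyState N T_L T_R (μ N T_L T_R)) →
    ∀ T : ℝ, 0 < T → ∀ D : ℕ → ℝ,
      (∀ N : ℕ, Tendsto (fun δ : ℝ =>
        (pinnedChain ω₂ lam β γ).totalCurrent (μ N (T + δ / 2) (T - δ / 2)) / δ)
        (nhdsWithin 0 {(0 : ℝ)}ᶜ) (nhds (D N))) →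
    ∃ C : ℝ, ∀ N M : ℕ, 2 ≤ N → 2 ≤ M →
      ((N + M - 1 : ℕ) : ℝ) / D (N + M) ≤ ((N - 1 : ℕ) : ℝ) / D N + ((M - 1 : ℕ) : ℝ) / D M + C) := by
  intro hU hD ω₂ lam β γ hω hl hβ hγ huniq μ hμ T hT D hDlim
  obtain ⟨C₁, hC₁⟩ := hU ω₂ lam β γ hω hl hβ hγ huniq μ hμ T hT D hDlim
  obtain ⟨C₂, hC₂⟩ := hD ω₂ lam β γ hω hl hβ hγ huniq μ hμ T hT D hDlim
  refine ⟨C₁ + C₂, fun N M hN hM => ?_⟩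
  -- the probe site: last site `N - 1` of the upstream block, as a site of the `(N+M)`-chain
  let s : Fin (N + M) := ⟨N - 1, by omega⟩
  have hs : s.val = N - 1 := rfl
  have h1 := hC₁ N M hN hM s hs
  have h2 := hC₂ N M hN hM s hs
  -- one common positive bias in both eventualities
  obtain ⟨δ, ⟨h1δ, h2δ⟩, hδmem⟩ := ((h1.and h2).and self_mem_nhdsWithin).exists
  have hδpos : (0 : ℝ) < δ := hδmem
  have hδne : δ ≠ 0 := ne_of_gt hδpos
  -- abbreviations
  set τ : ℝ := ∫ x, (x.2 s) ^ 2 ∂(μ (N + M) (T + δ / 2) (T - δ / 2)) with hτ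
  set R : ℝ := ((N + M - 1 : ℕ) : ℝ) / D (N + M) with hR
  -- the drop fractions sum to one: the probe temperature cancels
  have hsum : (T + δ / 2 - τ) / δ + (τ - (T - δ / 2)) / δ = 1 := by
    rw [← add_div]
    have : T + δ / 2 - τ + (τ - (T - δ / 2)) = δ := by ring
    rw [this, div_self hδne]
  have hsplit : R = (T + δ / 2 - τ) / δ * R + (τ - (T - δ / 2)) / δ * R := by
    rw [← add_mul, hsum, one_mul]
  calc ((N + M - 1 : ℕ) : ℝ) / D (N + M) = R := rfl
    _ = (T + δ / 2 - τ) / δ * R + (τ - (T - δ / 2)) / δ * R := hsplit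
    _ ≤ (((N - 1 : ℕ) : ℝ) / D N + C₁) + (((M - 1 : ℕ) : ℝ) / D M + C₂) := add_le_add h1δ h2δ
    _ = ((N - 1 : ℕ) : ℝ) / D N + ((M - 1 : ℕ) : ℝ) / D M + (C₁ + C₂) := by ring

/-- **Skeleton theorem — the crux `FeketeSeriesLaw.QuasiSubadditiveResistance` BY NAME from the two
registered stubs** (the only theorem of this file concluding the crux; its `sorry`s are exactly those
of `stub_upstreamTermination` and `stub_downstreamTermination`; the seam
`quasiSubadditiveResistance_of_stubs` is sorry-free). -/
theorem QuasiSubadditiveResistance_of :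
    _root_.Summit.AtomisticToContinuum.FouriersLaw.Theses.FeketeSeriesLaw.QuasiSubadditiveResistance :=
  quasiSubadditiveResistance_of_stubs stub_upstreamTermination stub_downstreamTermination

end Summit.AtomisticToContinuum.FouriersLaw.Cruxes.QuasiSubadditiveResistance.Birth
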